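import Summits.BirchSwinnertonDyer.BirchSwinnertonDyer.Theorems.CountingDoorF2AtThreeMemberwiseGenericity
import Summits.BirchSwinnertonDyer.BirchSwinnertonDyer.Theorems.CountingDoorF2AtThreeSelmerNineKernel
import Summits.BirchSwinnertonDyer.BirchSwinnertonDyer.Theorems.CountingDoorF2AtThreeSchneiderOnDoorSubfamilyStubHasDensityOnOneOfForall
import Literature.NumberTheory.EllipticCurves.BhargavaHo2022.LargeFamilyCount
import HarnessLib

/-!
# BirchSwinnertonDyer / CountingDoorF2AtThree — the PURE CONGRUENCE family of the three door classes has
# positive lower RELATIVE DENSITY in `F₂`; UNCONDITIONALLY a positive proportion of `F₂` has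
# `E(ℚ)_tors = 0 ∧ rank ≥ 2`; the FACT-FREE weak leaf holds on ALL of `F₂`

Route-free file of cell bsd-rank2 (seat bsd-rank2-eng-2 GEN 3), `--supports` crux I1
`SelmerThreeAverageLargeF2` (stmt-BirchSwinnertonDyer-19440) of `route-BirchSwinnertonDyer-CountingDoorF2AtThree`;
companion of `CountingDoorF2AtThreeMemberwiseGenericity` (every member of the classes `(1,0,1,0) mod 3`,
`(1,2,4,3) mod 7`, `(9,8,3,3) mod 13` has trivial torsion and rank `≥ 2`). Transporting a positive
proportion from a subfamily `Φ` to `F₂` needs positive lower relative density of `Φ` in `F₂`: for a LARGE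
family that is Bhargava–Ho Thm. 9.1 (the fact `thm9_1_F2` inside `LargeFamilyInputsF2`); for the PURE
congruence family `Φ₀'` of the three classes it is elementary and proved here.
* §1–§3: `N_k(X) := Nat.findGreatest (· ^ k < X) X` (`z^k < X ↔ z ≤ N_k`); `card_all_below_le`:
  `#F₂(<X) ≤ (2N₁₂+1)(2N₆+1)²(2N₄+1)`; `le_card_classFamily_below`:
  `(N₁₂/273)·((N₆/2)/273)²·(N₄/273) ≤ #Φ₀'(<X)` (the parameters `(22,177,172,3) + 273·i` in the
  half-box are distinct members — `13 ∤ Δ` on the class — of height `< X`).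
* §4 `eventually_card_all_le_mul_card_classFamily` (`X > 546¹²`: `#F₂(<X) ≤ 1024·273⁴·#Φ₀'(<X)`),
  `hasPositiveLowerDensityOn_all_of_relative` (positive proportions transfer to `F₂`).
* §5 **`hasPositiveLowerDensityOn_all_torsionOrder_eq_one_and_two_le_rank`** (UNCONDITIONAL positive
  proportion of `F₂` with trivial torsion and rank `≥ 2` — the positive-proportion shadow of BH Thm. 10.1,
  by congruences and reduction mod `3·7·13`); **`weakLeaf_all_of_selmerNineDensity_factFree`** (D9 ⇒ a
  positive proportion of ALL of `F₂` has `rank = 2 ∧ Ш[3^∞] = 0`, NO published input; compare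
  `Theorems.weakLeaf_all_of_selmerNineDensity`, which takes `LargeFamilyInputsF2`);
  `rootNumberPlusPositiveDensity_all_of_selmerNineDensity_factFree` (D9 + `3`-parity ⇒ `w = +1` positively often).

THEOREMS ONLY (no definition, no named fact, no `sorry`). PARTITION: none — r_an ≥ 2, summit axis S0
(D-0036(1) funded rung); TWIN (D-0056): n/a. B1 honesty: elementary lattice-point counting and
congruence-class bookkeeping; D9 is a hypothesis where used; nothing reads an analytic rank; no S0 motion.
References: Bhargava–Ho arXiv:2207.03309 §1, Thm. 9.1/10.1 [BhargavaHo2022]; Silverman *AEC* VII.3.1(b), VIII.6.7 [SilvermanAEC2009].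
-/

set_option linter.dupNamespace false

noncomputable section

open scoped Classical
open Filter Topology
open WeierstrassCurve Literature.NumberTheory.EllipticCurves
  Literature.NumberTheory.EllipticCurves.BhargavaHo2022
  Summit.BirchSwinnertonDyer.Rank2

namespace Summit.BirchSwinnertonDyer.BirchSwinnertonDyer.Theorems

/-! ### §1 Counting integers: `k`-th power below `X`, residue classes in an initial segment -/

/-- For `0 < X` and `k ≠ 0`, `z ^ k < X ↔ z ≤ N` with `N = Nat.findGreatest (· ^ k < X) X` the largest
`k`-th-power-below-`X` integer. [folklore] -/
theorem pow_lt_iff_le_findGreatest {k X : ℕ} (hk : k ≠ 0) (hX : 0 < X) (z : ℕ) :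
    z ^ k < X ↔ z ≤ Nat.findGreatest (fun m ↦ m ^ k < X) X := by
  constructor
  · intro hz
    refine Nat.le_findGreatest ?_ hz
    rcases Nat.eq_zero_or_pos z with rfl | hzpos
    · exact Nat.zero_le _
    · exact ((Nat.le_self_pow hk z).trans hz.le)
  · intro hz
    have hspec : (Nat.findGreatest (fun m ↦ m ^ k < X) X) ^ k < X :=
      Nat.findGreatest_spec (P := fun m ↦ m ^ k < X) (Nat.zero_le X) (by simpa [hk] using hX)
    exact lt_of_le_of_lt (Nat.pow_le_pow_left hz k) hspec

/-- An integer with `|z| ^ k < X` (`0 < X`, `k ≠ 0`) lies in `[-N, N]`, `N = Nat.findGreatest (· ^ k < X) X`.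
[folklore] -/
theorem abs_le_findGreatest_of_pow_lt {k X : ℕ} (hk : k ≠ 0) (hX : 0 < X) {z : ℤ}
    (hz : |z| ^ k < (X : ℤ)) : |z| ≤ (Nat.findGreatest (fun m ↦ m ^ k < X) X : ℤ) := by
  have h : z.natAbs ^ k < X := by
    have : ((z.natAbs : ℕ) : ℤ) ^ k < X := by rw [Int.natCast_natAbs]; exact hz
    exact_mod_cast this
  have := (pow_lt_iff_le_findGreatest hk hX z.natAbs).mp h
  rw [← Int.natCast_natAbs]
  exact_mod_cast this

/-! ### §2 The pure congruence family of the three door classes and its members of bounded height -/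

/-- **The pure congruence family `Φ₀'` of the classes `(1,0,1,0) mod 3`, `(1,2,4,3) mod 7`,
`(9,8,3,3) mod 13`** (no condition at any other prime): large, every residue set nonempty, membership
characterised by the twelve residues. [cite: BhargavaHo2022, §1 (large subfamilies defined by congruence conditions)] -/
theorem exists_classFamily₃₇₁₃ :
    ∃ Φ : CongruenceFamily₂, Φ.IsLarge ∧ (∀ p : ℕ, p.Prime → (Φ.residues p).Nonempty) ∧
      ∀ a : Params, Φ.Mem a ↔ a.IsMember ∧
        ((a.a₁ : ZMod 3) = 1 ∧ (a.a₂ : ZMod 3) = 0 ∧ (a.a₂' : ZMod 3) = 1 ∧ (a.a₃ : ZMod 3) = 0) ∧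
        ((a.a₁ : ZMod 7) = 1 ∧ (a.a₂ : ZMod 7) = 2 ∧ (a.a₂' : ZMod 7) = 4 ∧ (a.a₃ : ZMod 7) = 3) ∧
        ((a.a₁ : ZMod 13) = 9 ∧ (a.a₂ : ZMod 13) = 8 ∧ (a.a₂' : ZMod 13) = 3 ∧
          (a.a₃ : ZMod 13) = 3) := by
  -- residue sets: the class of `r = (22, 177, 172, 3)` at `3, 7, 13`; everything elsewhere
  let r : Params := ⟨22, 177, 172, 3⟩
  obtain ⟨Φ, hΦ⟩ : ∃ Φ : CongruenceFamily₂, ∀ (p : ℕ) (a : Params),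
      Φ.residueOf p a ∈ Φ.residues p ↔ ((p = 3 ∨ p = 7 ∨ p = 13) →
        (a.a₁ : ZMod (p ^ 1)) = r.a₁ ∧ (a.a₂ : ZMod (p ^ 1)) = r.a₂ ∧
          (a.a₂' : ZMod (p ^ 1)) = r.a₂' ∧ (a.a₃ : ZMod (p ^ 1)) = r.a₃) :=
    ⟨⟨fun _ ↦ 1, fun p ↦ {ρ | (p = 3 ∨ p = 7 ∨ p = 13) →
        ρ.1 = r.a₁ ∧ ρ.2.1 = r.a₂ ∧ ρ.2.2.1 = r.a₂' ∧ ρ.2.2.2 = r.a₃}⟩, fun _ _ ↦ Iff.rfl⟩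
  have h3₁ : ((r.a₁ : ℤ) : ZMod (3 ^ 1)) = 1 := by decide
  have h3₂ : ((r.a₂ : ℤ) : ZMod (3 ^ 1)) = 0 := by decide
  have h3₂' : ((r.a₂' : ℤ) : ZMod (3 ^ 1)) = 1 := by decide
  have h3₃ : ((r.a₃ : ℤ) : ZMod (3 ^ 1)) = 0 := by decide
  have h7₁ : ((r.a₁ : ℤ) : ZMod (7 ^ 1)) = 1 := by decide
  have h7₂ : ((r.a₂ : ℤ) : ZMod (7 ^ 1)) = 2 := by decide
  have h7₂' : ((r.a₂' : ℤ) : ZMod (7 ^ 1)) = 4 := by decide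
  have h7₃ : ((r.a₃ : ℤ) : ZMod (7 ^ 1)) = 3 := by decide
  have h13₁ : ((r.a₁ : ℤ) : ZMod (13 ^ 1)) = 9 := by decide
  have h13₂ : ((r.a₂ : ℤ) : ZMod (13 ^ 1)) = 8 := by decide
  have h13₂' : ((r.a₂' : ℤ) : ZMod (13 ^ 1)) = 3 := by decide
  have h13₃ : ((r.a₃ : ℤ) : ZMod (13 ^ 1)) = 3 := by decide
  refine ⟨Φ, ⟨14, fun p h14 _ a _ _ ↦ (hΦ p a).mpr ?_⟩, fun p _ ↦ ⟨Φ.residueOf p r, (hΦ p r).mpr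
    fun _ ↦ ⟨rfl, rfl, rfl, rfl⟩⟩, fun a ↦ ⟨fun ⟨ha, hres⟩ ↦ ?_, fun ⟨ha, h3, h7, h13⟩ ↦ ⟨ha, ?_⟩⟩⟩
  · rintro (rfl | rfl | rfl) <;> omega
  · have e3 := (hΦ 3 a).mp (hres 3 Nat.prime_three) (Or.inl rfl)
    have e7 := (hΦ 7 a).mp (hres 7 (by norm_num)) (Or.inr (Or.inl rfl))
    have e13 := (hΦ 13 a).mp (hres 13 (by norm_num)) (Or.inr (Or.inr rfl))
    rw [h3₁, h3₂, h3₂', h3₃] at e3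
    rw [h7₁, h7₂, h7₂', h7₃] at e7
    rw [h13₁, h13₂, h13₂', h13₃] at e13
    exact ⟨ha, e3, e7, e13⟩
  · intro p hp
    refine (hΦ p a).mpr ?_
    rintro (rfl | rfl | rfl)
    · rw [h3₁, h3₂, h3₂', h3₃]; exact h3
    · rw [h7₁, h7₂, h7₂', h7₃]; exact h7
    · rw [h13₁, h13₂, h13₂', h13₃]; exact h13

/-! ### §3 Counting: `#F₂(<X)` from above, `#Φ₀'(<X)` from below -/

/-- **Upper box count**: every member of `F₂` of height `< X` has `|a₁| ≤ N₁₂`, `|a₂|, |a₂'| ≤ N₆`,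
`|a₃| ≤ N₄` (`N_k` the largest integer with `N_k^k < X`), so
`#F₂(<X) ≤ (2N₁₂+1)(2N₆+1)²(2N₄+1)`. [cite: BhargavaHo2022, §1 (definition of the height on F₂)] -/
theorem card_all_below_le (X : ℕ) (hX : 0 < X) :
    (CongruenceFamily₂.all.below X).card ≤
      (2 * Nat.findGreatest (fun m ↦ m ^ 12 < X) X + 1) *
        ((2 * Nat.findGreatest (fun m ↦ m ^ 6 < X) X + 1) *
          ((2 * Nat.findGreatest (fun m ↦ m ^ 6 < X) X + 1) *
            (2 * Nat.findGreatest (fun m ↦ m ^ 4 < X) X + 1))) := by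
  set N₁₂ := Nat.findGreatest (fun m ↦ m ^ 12 < X) X
  set N₆ := Nat.findGreatest (fun m ↦ m ^ 6 < X) X
  set N₄ := Nat.findGreatest (fun m ↦ m ^ 4 < X) X
  set T : Finset (ℤ × ℤ × ℤ × ℤ) := Finset.Icc (-(N₁₂ : ℤ)) N₁₂ ×ˢ (Finset.Icc (-(N₆ : ℤ)) N₆ ×ˢ
    (Finset.Icc (-(N₆ : ℤ)) N₆ ×ˢ Finset.Icc (-(N₄ : ℤ)) N₄)) with hT
  have hI : ∀ N : ℕ, (Finset.Icc (-(N : ℤ)) N).card = 2 * N + 1 := fun N ↦ by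
    rw [Int.card_Icc]; omega
  have hcardT : T.card = (2 * N₁₂ + 1) * ((2 * N₆ + 1) * ((2 * N₆ + 1) * (2 * N₄ + 1))) := by
    rw [hT, Finset.card_product, Finset.card_product, Finset.card_product, hI, hI, hI]
  rw [← hcardT]
  refine Finset.card_le_card_of_injOn (fun a ↦ (a.a₁, a.a₂, a.a₂', a.a₃)) (fun a ha ↦ ?_) ?_
  · rw [Finset.mem_coe, CongruenceFamily₂.mem_below_iff] at ha
    have hH := ha.2
    have hX' : (0 : ℤ) ≤ X := by positivity
    simp only [Params.height, max_lt_iff] at hH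
    obtain ⟨⟨⟨⟨h1, h2⟩, h2'⟩, -⟩, h3⟩ := hH
    have b1 := abs_le_findGreatest_of_pow_lt (by norm_num) hX h1
    have b2 := abs_le_findGreatest_of_pow_lt (by norm_num) hX h2
    have b2' := abs_le_findGreatest_of_pow_lt (by norm_num) hX h2'
    have b3 := abs_le_findGreatest_of_pow_lt (by norm_num) hX h3
    simp only [hT, Finset.coe_product, Set.mem_prod, Finset.coe_Icc, Set.mem_Icc]
    exact ⟨abs_le.mp b1, abs_le.mp b2, abs_le.mp b2', abs_le.mp b3⟩
  · rintro ⟨a₁, a₂, a₂', a₃⟩ - ⟨b₁, b₂, b₂', b₃⟩ - h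
    simp only [Prod.mk.injEq] at h
    obtain ⟨rfl, rfl, rfl, rfl⟩ := h
    rfl

/-- A shifted residue class representative `r + M i` reduces to `r` modulo `n` when `n ∣ M`.
[folklore] -/
theorem intCast_add_mul_zmod_eq {n : ℕ} (r M : ℤ) (i : ℕ) (hM : (M : ZMod n) = 0) :
    ((r + M * i : ℤ) : ZMod n) = (r : ZMod n) := by
  push_cast; rw [hM, zero_mul, add_zero]

/-- **Lower box count for the pure congruence family** `Φ₀'` (membership = the three classes): the
parameters `(22 + 273 i₁, 177 + 273 i₂, 172 + 273 i₂', 3 + 273 i₃)` with `i₁ < N₁₂/273`,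
`i₂, i₂' < (N₆/2)/273`, `i₃ < N₄/273` are distinct members of `Φ₀'` of height `< X`
(`Δ ≠ 0` because `13 ∤ Δ` on the class), whence
`(N₁₂/273)·((N₆/2)/273)²·(N₄/273) ≤ #Φ₀'(<X)`. [cite: BhargavaHo2022, §1 (definition of the height on F₂)] -/
theorem le_card_classFamily_below (Φ : CongruenceFamily₂)
    (hkey : ∀ a : Params, Φ.Mem a ↔ a.IsMember ∧
      ((a.a₁ : ZMod 3) = 1 ∧ (a.a₂ : ZMod 3) = 0 ∧ (a.a₂' : ZMod 3) = 1 ∧ (a.a₃ : ZMod 3) = 0) ∧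
      ((a.a₁ : ZMod 7) = 1 ∧ (a.a₂ : ZMod 7) = 2 ∧ (a.a₂' : ZMod 7) = 4 ∧ (a.a₃ : ZMod 7) = 3) ∧
      ((a.a₁ : ZMod 13) = 9 ∧ (a.a₂ : ZMod 13) = 8 ∧ (a.a₂' : ZMod 13) = 3 ∧ (a.a₃ : ZMod 13) = 3))
    (X : ℕ) (hX : 0 < X) :
    (Nat.findGreatest (fun m ↦ m ^ 12 < X) X / 273) *
      (((Nat.findGreatest (fun m ↦ m ^ 6 < X) X / 2) / 273) *
        (((Nat.findGreatest (fun m ↦ m ^ 6 < X) X / 2) / 273) *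
          (Nat.findGreatest (fun m ↦ m ^ 4 < X) X / 273))) ≤ (Φ.below X).card := by
  set N₁₂ := Nat.findGreatest (fun m ↦ m ^ 12 < X) X with hN₁₂
  set N₆ := Nat.findGreatest (fun m ↦ m ^ 6 < X) X with hN₆
  set N₄ := Nat.findGreatest (fun m ↦ m ^ 4 < X) X with hN₄
  set S : Finset (ℕ × ℕ × ℕ × ℕ) := Finset.range (N₁₂ / 273) ×ˢ (Finset.range ((N₆ / 2) / 273) ×ˢ
    (Finset.range ((N₆ / 2) / 273) ×ˢ Finset.range (N₄ / 273))) with hS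
  have hcardS : S.card = (N₁₂ / 273) * (((N₆ / 2) / 273) * (((N₆ / 2) / 273) * (N₄ / 273))) := by
    rw [hS, Finset.card_product, Finset.card_product, Finset.card_product, Finset.card_range,
      Finset.card_range, Finset.card_range]
  rw [← hcardS]
  refine Finset.card_le_card_of_injOn
    (fun i ↦ (⟨22 + 273 * (i.1 : ℤ), 177 + 273 * (i.2.1 : ℤ), 172 + 273 * (i.2.2.1 : ℤ),
      3 + 273 * (i.2.2.2 : ℤ)⟩ : Params)) (fun i hi ↦ ?_) ?_
  · obtain ⟨i₁, i₂, i₂', i₃⟩ := i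
    simp only [hS, Finset.coe_product, Set.mem_prod, Finset.coe_range, Set.mem_Iio] at hi
    obtain ⟨hi₁, hi₂, hi₂', hi₃⟩ := hi
    rw [Finset.mem_coe, CongruenceFamily₂.mem_below_iff]
    -- the classes
    have c3 : (((22 + 273 * (i₁ : ℤ) : ℤ) : ZMod 3) = 1 ∧ ((177 + 273 * (i₂ : ℤ) : ℤ) : ZMod 3) = 0 ∧
        ((172 + 273 * (i₂' : ℤ) : ℤ) : ZMod 3) = 1 ∧ ((3 + 273 * (i₃ : ℤ) : ℤ) : ZMod 3) = 0) := by
      refine ⟨?_, ?_, ?_, ?_⟩ <;> rw [intCast_add_mul_zmod_eq _ _ _ (by decide)] <;> decide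
    have c7 : (((22 + 273 * (i₁ : ℤ) : ℤ) : ZMod 7) = 1 ∧ ((177 + 273 * (i₂ : ℤ) : ℤ) : ZMod 7) = 2 ∧
        ((172 + 273 * (i₂' : ℤ) : ℤ) : ZMod 7) = 4 ∧ ((3 + 273 * (i₃ : ℤ) : ℤ) : ZMod 7) = 3) := by
      refine ⟨?_, ?_, ?_, ?_⟩ <;> rw [intCast_add_mul_zmod_eq _ _ _ (by decide)] <;> decide
    have c13 : (((22 + 273 * (i₁ : ℤ) : ℤ) : ZMod 13) = 9 ∧ ((177 + 273 * (i₂ : ℤ) : ℤ) : ZMod 13) = 8 ∧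
        ((172 + 273 * (i₂' : ℤ) : ℤ) : ZMod 13) = 3 ∧ ((3 + 273 * (i₃ : ℤ) : ℤ) : ZMod 13) = 3) := by
      refine ⟨?_, ?_, ?_, ?_⟩ <;> rw [intCast_add_mul_zmod_eq _ _ _ (by decide)] <;> decide
    -- `Δ ≠ 0` from the class at `13`
    have hmem : (⟨22 + 273 * (i₁ : ℤ), 177 + 273 * (i₂ : ℤ), 172 + 273 * (i₂' : ℤ),
        3 + 273 * (i₃ : ℤ)⟩ : Params).IsMember := by
      intro h0
      have h13 := params_not_thirteen_dvd_Δ_of_class ⟨22 + 273 * (i₁ : ℤ), 177 + 273 * (i₂ : ℤ),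
        172 + 273 * (i₂' : ℤ), 3 + 273 * (i₃ : ℤ)⟩ c13.1 c13.2.1 c13.2.2.1 c13.2.2.2
      exact h13 (h0 ▸ dvd_zero _)
    refine ⟨(hkey _).mpr ⟨hmem, c3, c7, c13⟩, ?_⟩
    -- the height
    have hq₁ : 273 * (N₁₂ / 273) ≤ N₁₂ := Nat.mul_div_le _ _
    have hq₆ : 273 * ((N₆ / 2) / 273) ≤ N₆ / 2 := Nat.mul_div_le _ _
    have hq₆' : 2 * (N₆ / 2) ≤ N₆ := Nat.mul_div_le _ _
    have hq₄ : 273 * (N₄ / 273) ≤ N₄ := Nat.mul_div_le _ _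
    have ha₁ : 22 + 273 * i₁ ≤ N₁₂ := by omega
    have ha₂ : 177 + 273 * i₂ ≤ N₆ / 2 := by omega
    have ha₂' : 172 + 273 * i₂' ≤ N₆ / 2 := by omega
    have ha₃ : 3 + 273 * i₃ ≤ N₄ := by omega
    have p₁ := (pow_lt_iff_le_findGreatest (k := 12) (by norm_num) hX _).mpr ha₁
    have p₂ := (pow_lt_iff_le_findGreatest (k := 6) (by norm_num) hX _).mpr (ha₂.trans (Nat.div_le_self _ _))
    have p₂' := (pow_lt_iff_le_findGreatest (k := 6) (by norm_num) hX _).mpr (ha₂'.trans (Nat.div_le_self _ _))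
    have p₂₂ : (177 + 273 * i₂ + (172 + 273 * i₂')) ^ 6 < X :=
      (pow_lt_iff_le_findGreatest (k := 6) (by norm_num) hX _).mpr (by omega)
    have p₃ := (pow_lt_iff_le_findGreatest (k := 4) (by norm_num) hX _).mpr ha₃
    simp only [Params.height, max_lt_iff]
    refine ⟨⟨⟨⟨?_, ?_⟩, ?_⟩, ?_⟩, ?_⟩
    · rw [show |(22 + 273 * (i₁ : ℤ) : ℤ)| = ((22 + 273 * i₁ : ℕ) : ℤ) by push_cast; exact abs_of_nonneg (by positivity)]
      exact_mod_cast p₁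
    · rw [show |(177 + 273 * (i₂ : ℤ) : ℤ)| = ((177 + 273 * i₂ : ℕ) : ℤ) by push_cast; exact abs_of_nonneg (by positivity)]
      exact_mod_cast p₂
    · rw [show |(172 + 273 * (i₂' : ℤ) : ℤ)| = ((172 + 273 * i₂' : ℕ) : ℤ) by push_cast; exact abs_of_nonneg (by positivity)]
      exact_mod_cast p₂'
    · rw [show |(177 + 273 * (i₂ : ℤ) + (172 + 273 * (i₂' : ℤ)) : ℤ)| =
          ((177 + 273 * i₂ + (172 + 273 * i₂') : ℕ) : ℤ) by push_cast; exact abs_of_nonneg (by positivity)]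
      exact_mod_cast p₂₂
    · rw [show |(3 + 273 * (i₃ : ℤ) : ℤ)| = ((3 + 273 * i₃ : ℕ) : ℤ) by push_cast; exact abs_of_nonneg (by positivity)]
      exact_mod_cast p₃
  · rintro ⟨i₁, i₂, i₂', i₃⟩ - ⟨j₁, j₂, j₂', j₃⟩ - h
    simp only [Params.mk.injEq] at h
    obtain ⟨h₁, h₂, h₂', h₃⟩ := h
    simp only [Prod.mk.injEq]
    refine ⟨?_, ?_, ?_, ?_⟩ <;> omega

/-! ### §4 Positive lower relative density of `Φ₀'` in `F₂`, and the transfer of positive proportions -/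

/-- **`Φ₀'` has positive lower relative density in `F₂`**: eventually
`#F₂(<X) ≤ 1024·273⁴ · #Φ₀'(<X)` (for `X > 546¹²`: `N₁₂, N₆, N₄ ≥ 546`, and then
`2N+1 ≤ 4·273·(N/273)`, `2N₆+1 ≤ 8·273·((N₆/2)/273)`). Elementary lattice-point counting; no
equidistribution or sieve is used. [cite: BhargavaHo2022, §1 (large subfamilies; ordering by height)] -/
theorem eventually_card_all_le_mul_card_classFamily (Φ : CongruenceFamily₂)
    (hkey : ∀ a : Params, Φ.Mem a ↔ a.IsMember ∧
      ((a.a₁ : ZMod 3) = 1 ∧ (a.a₂ : ZMod 3) = 0 ∧ (a.a₂' : ZMod 3) = 1 ∧ (a.a₃ : ZMod 3) = 0) ∧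
      ((a.a₁ : ZMod 7) = 1 ∧ (a.a₂ : ZMod 7) = 2 ∧ (a.a₂' : ZMod 7) = 4 ∧ (a.a₃ : ZMod 7) = 3) ∧
      ((a.a₁ : ZMod 13) = 9 ∧ (a.a₂ : ZMod 13) = 8 ∧ (a.a₂' : ZMod 13) = 3 ∧ (a.a₃ : ZMod 13) = 3)) :
    ∀ᶠ X : ℕ in atTop, (CongruenceFamily₂.all.below X).card ≤ 1024 * 273 ^ 4 * (Φ.below X).card := by
  refine Filter.eventually_atTop.mpr ⟨546 ^ 12 + 1, fun X hX ↦ ?_⟩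
  have hX0 : 0 < X := by omega
  set N₁₂ := Nat.findGreatest (fun m ↦ m ^ 12 < X) X with hN₁₂
  set N₆ := Nat.findGreatest (fun m ↦ m ^ 6 < X) X with hN₆
  set N₄ := Nat.findGreatest (fun m ↦ m ^ 4 < X) X with hN₄
  have h12 : 546 ≤ N₁₂ := (pow_lt_iff_le_findGreatest (k := 12) (by norm_num) hX0 546).mp (by omega)
  have h6 : 546 ≤ N₆ := (pow_lt_iff_le_findGreatest (k := 6) (by norm_num) hX0 546).mp
    (lt_of_le_of_lt (Nat.pow_le_pow_right (by norm_num) (by norm_num : 6 ≤ 12)) (by omega))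
  have h4 : 546 ≤ N₄ := (pow_lt_iff_le_findGreatest (k := 4) (by norm_num) hX0 546).mp
    (lt_of_le_of_lt (Nat.pow_le_pow_right (by norm_num) (by norm_num : 4 ≤ 12)) (by omega))
  have A₁₂ : 2 * N₁₂ + 1 ≤ 1092 * (N₁₂ / 273) := by omega
  have A₆ : 2 * N₆ + 1 ≤ 2184 * ((N₆ / 2) / 273) := by omega
  have A₄ : 2 * N₄ + 1 ≤ 1092 * (N₄ / 273) := by omega
  calc (CongruenceFamily₂.all.below X).card
      ≤ (2 * N₁₂ + 1) * ((2 * N₆ + 1) * ((2 * N₆ + 1) * (2 * N₄ + 1))) := card_all_below_le X hX0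
    _ ≤ (1092 * (N₁₂ / 273)) * ((2184 * ((N₆ / 2) / 273)) * ((2184 * ((N₆ / 2) / 273)) *
          (1092 * (N₄ / 273)))) := by gcongr
    _ = 1024 * 273 ^ 4 * ((N₁₂ / 273) * (((N₆ / 2) / 273) * (((N₆ / 2) / 273) * (N₄ / 273)))) := by
        ring
    _ ≤ 1024 * 273 ^ 4 * (Φ.below X).card :=
        Nat.mul_le_mul_left _ (le_card_classFamily_below Φ hkey X hX0)

/-- **Transfer of positive proportions from a subfamily of positive lower relative density to `F₂`**
(pure counting): if eventually `#F₂(<X) ≤ C · #Φ(<X)` and `P` has lower density `≥ δ > 0` in `Φ`, then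
`P` has lower density `≥ δ / C` in `F₂`. [folklore] -/
theorem hasPositiveLowerDensityOn_all_of_relative (Φ : CongruenceFamily₂) {C : ℕ} (hC : 0 < C)
    (hrel : ∀ᶠ X : ℕ in atTop, (CongruenceFamily₂.all.below X).card ≤ C * (Φ.below X).card)
    {P : Params → Prop} (hP : Φ.HasPositiveLowerDensityOn P) :
    CongruenceFamily₂.all.HasPositiveLowerDensityOn P := by
  obtain ⟨δ, hδ, hev⟩ := hP
  refine ⟨δ / C, by positivity, ?_⟩
  filter_upwards [hrel, hev, eventually_card_below_pos_all] with X hXrel hXP hXpos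
  rw [proportionOn_eq_card_filter_div] at hXP ⊢
  have hΦpos : 0 < ((Φ.below X).card : ℝ) := by
    rcases Nat.eq_zero_or_pos (Φ.below X).card with h0 | hpos
    · exfalso; rw [h0, Nat.cast_zero, div_zero] at hXP; linarith
    · exact_mod_cast hpos
  have hall : (0 : ℝ) < (CongruenceFamily₂.all.below X).card := by exact_mod_cast hXpos
  have h1 : δ * (Φ.below X).card ≤ (((Φ.below X).filter P).card : ℝ) := by
    rwa [le_div_iff₀ hΦpos] at hXP
  have h2 : (((Φ.below X).filter P).card : ℝ) ≤ ((CongruenceFamily₂.all.below X).filter P).card := by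
    exact_mod_cast Finset.card_le_card
      (Finset.filter_subset_filter P (CongruenceFamily₂.below_subset_all_below Φ X))
  have h3 : ((CongruenceFamily₂.all.below X).card : ℝ) ≤ C * (Φ.below X).card := by exact_mod_cast hXrel
  rw [le_div_iff₀ hall]
  calc δ / C * (CongruenceFamily₂.all.below X).card ≤ δ / C * (C * (Φ.below X).card) := by gcongr
    _ = δ * (Φ.below X).card := by field_simp
    _ ≤ _ := h1.trans h2

/-! ### §5 Consequences: an UNCONDITIONAL positive proportion of `F₂` with `E(ℚ)_tors = 0 ∧ rank ≥ 2`,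
and the fact-free weak leaf on ALL of `F₂` -/

/-- `Φ₀'` with its generic-members input: large, nonempty residue sets, the membership characterisation,
and `torsionOrder = 1 ∧ rank ≥ 2` with density one (indeed for every member, by
`params_torsionOrder_eq_one_and_two_le_rank_of_classes`; the member `(22,177,172,3)` makes the height balls
nonempty). [cite: BhargavaHo2022, §1 (large subfamilies defined by congruence conditions)] -/
theorem exists_classFamily₃₇₁₃_generic :
    ∃ Φ : CongruenceFamily₂, Φ.IsLarge ∧ (∀ p : ℕ, p.Prime → (Φ.residues p).Nonempty) ∧
      (∀ a : Params, Φ.Mem a ↔ a.IsMember ∧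
        ((a.a₁ : ZMod 3) = 1 ∧ (a.a₂ : ZMod 3) = 0 ∧ (a.a₂' : ZMod 3) = 1 ∧ (a.a₃ : ZMod 3) = 0) ∧
        ((a.a₁ : ZMod 7) = 1 ∧ (a.a₂ : ZMod 7) = 2 ∧ (a.a₂' : ZMod 7) = 4 ∧ (a.a₃ : ZMod 7) = 3) ∧
        ((a.a₁ : ZMod 13) = 9 ∧ (a.a₂ : ZMod 13) = 8 ∧ (a.a₂' : ZMod 13) = 3 ∧
          (a.a₃ : ZMod 13) = 3)) ∧
      Φ.HasDensityOn (fun a ↦ a.curve.torsionOrder = 1 ∧ 2 ≤ a.curve.mordellWeilRank) 1 := by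
  obtain ⟨Φ, hL, hne, hkey⟩ := exists_classFamily₃₇₁₃
  have hall : ∀ a, Φ.Mem a → a.curve.torsionOrder = 1 ∧ 2 ≤ a.curve.mordellWeilRank := by
    intro a ha
    obtain ⟨haM, ⟨h₁, h₂, h₂', h₃⟩, ⟨s₁, s₂, s₂', s₃⟩, ⟨t₁, t₂, t₂', t₃⟩⟩ := (hkey a).mp ha
    exact params_torsionOrder_eq_one_and_two_le_rank_of_classes a haM h₁ h₂ h₂' h₃ s₁ s₂ s₂' s₃
      t₁ t₂ t₂' t₃
  -- `r = (22, 177, 172, 3)` is a member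
  have hr : Φ.Mem ⟨22, 177, 172, 3⟩ := by
    refine (hkey _).mpr ⟨fun h0 ↦ ?_, by decide, by decide, by decide⟩
    exact params_not_thirteen_dvd_Δ_of_class ⟨22, 177, 172, 3⟩ (by decide) (by decide) (by decide)
      (by decide) (h0 ▸ dvd_zero _)
  exact ⟨Φ, hL, hne, hkey,
    CountingDoorF2AtThreeSchneiderOnDoorSubfamilyStubHasDensityOnOneOfForall.stub_hasDensityOn_one_of_forall
      Φ _ ⟨_, hr⟩ hall⟩

/-- **Unconditionally, a positive proportion of Bhargava–Ho's family `F₂`, ordered by height, has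
trivial rational torsion and Mordell–Weil rank `≥ 2`** — the positive-proportion shadow of
Bhargava–Ho's Thm. 10.1 (`100 %`, vendored as the fact `thm10_1_F2`), proved here by congruences: the
pure congruence family `Φ₀'` of the three door classes is member-wise generic and has positive lower
relative density in `F₂`. [cite: BhargavaHo2022, Thm. 10.1] [cite: SilvermanAEC2009, Prop. VII.3.1(b) and Thm. VIII.6.7] -/
theorem hasPositiveLowerDensityOn_all_torsionOrder_eq_one_and_two_le_rank :
    CongruenceFamily₂.all.HasPositiveLowerDensityOn
      (fun a ↦ a.curve.torsionOrder = 1 ∧ 2 ≤ a.curve.mordellWeilRank) := by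
  obtain ⟨Φ, -, -, hkey, hGen⟩ := exists_classFamily₃₇₁₃_generic
  exact hasPositiveLowerDensityOn_all_of_relative Φ (C := 1024 * 273 ^ 4) (by norm_num)
    (eventually_card_all_le_mul_card_classFamily Φ hkey)
    (hasPositiveLowerDensityOn_of_densityOnGE Φ (densityOnGE_of_hasDensityOn Φ hGen) one_pos)

/-- **The FACT-FREE weak leaf on ALL of `F₂`.** If in every large subfamily of `F₂` with nonempty
residue sets the members with `#Sel₃(E_a) = 9` have positive lower density (D9), then a positive
proportion of ALL of `F₂`, ordered by height, has `rank E_a(ℚ) = 2` and `Ш(E_a)[3^∞] = 0` — no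
published input whatsoever (D9 on `Φ₀'`, member-wise genericity, pure counting `K1`, and the positive
lower relative density of `Φ₀'` in `F₂`). Compare `Theorems.weakLeaf_all_of_selmerNineDensity`, which
needs `LargeFamilyInputsF2`. [folklore] -/
theorem weakLeaf_all_of_selmerNineDensity_factFree
    (hD9 : ∀ Φ : CongruenceFamily₂, Φ.IsLarge → (∀ p : ℕ, p.Prime → (Φ.residues p).Nonempty) →
      Φ.HasPositiveLowerDensityOn (fun a ↦ Nat.card (a.curve.selmerGroup 3) = 9)) :
    CongruenceFamily₂.all.HasPositiveLowerDensityOn (fun a ↦ a.IsMember ∧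
      a.curve.mordellWeilRank = 2 ∧ AddCommGroup.primaryComponent a.curve.sha 3 = ⊥) := by
  obtain ⟨Φ, hL, hne, hkey, hGen⟩ := exists_classFamily₃₇₁₃_generic
  have hGood := hasDensityOn_rank_torsionBy_of_torsionOrder Φ 3 hGen
  have hD : Φ.HasPositiveLowerDensityOn (fun a ↦ Nat.card (a.curve.selmerGroup 3) = 3 ^ 2) :=
    hasPositiveLowerDensityOn_mono Φ (hD9 Φ hL hne) fun a h ↦ h.trans (by norm_num)
  exact hasPositiveLowerDensityOn_all_of_relative Φ (C := 1024 * 273 ^ 4) (by norm_num)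
    (eventually_card_all_le_mul_card_classFamily Φ hkey)
    (hasPositiveLowerDensityOn_rank_two_sha_bot_of_card_selmerGroup_eq_sq Φ 3 hGood hD)

/-- **D9 and Dokchitser–Dokchitser `3`-parity give root number `+1` for a positive proportion of ALL
of `F₂`** (no `LargeFamilyInputsF2`). [cite: DokchitserDokchitserAnnals2010, Thm 1.4 (p-parity)] -/
theorem rootNumberPlusPositiveDensity_all_of_selmerNineDensity_factFree
    (hDD : even_selmerRank_sub_torsionRank_iff)
    (hD9 : ∀ Φ : CongruenceFamily₂, Φ.IsLarge → (∀ p : ℕ, p.Prime → (Φ.residues p).Nonempty) →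
      Φ.HasPositiveLowerDensityOn (fun a ↦ Nat.card (a.curve.selmerGroup 3) = 9)) :
    CongruenceFamily₂.all.HasPositiveLowerDensityOn (fun a ↦ a.curve.rootNumber = 1) := by
  obtain ⟨Φ, hL, hne, hkey, hGen⟩ := exists_classFamily₃₇₁₃_generic
  have hGood := hasDensityOn_rank_torsionBy_of_torsionOrder Φ 3 hGen
  have hD : Φ.HasPositiveLowerDensityOn (fun a ↦ Nat.card (a.curve.selmerGroup 3) = 3 ^ 2) :=
    hasPositiveLowerDensityOn_mono Φ (hD9 Φ hL hne) fun a h ↦ h.trans (by norm_num)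
  exact hasPositiveLowerDensityOn_all_of_relative Φ (C := 1024 * 273 ^ 4) (by norm_num)
    (eventually_card_all_le_mul_card_classFamily Φ hkey)
    (hasPositiveLowerDensityOn_rootNumber_of_card_selmerGroup_eq_sq Φ 3 hDD hGood hD)

end Summit.BirchSwinnertonDyer.BirchSwinnertonDyer.Theorems

end
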